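import Summits.QuantumFields.BalabanUV.Beta.GAN24.CombLegMultiplierColumnEnvelope
import Summits.QuantumFields.BalabanUV.Beta.GAN24.CarrierKernelLegBlockL1
import Summits.QuantumFields.BalabanUV.Beta.GAN24.CombLin4Transport
import Summits.QuantumFields.BalabanUV.Beta.CombChartTransportLevel

/-!
# `BalabanUV.Beta.GAN24.CombCarrierKernelLegBlockL1` — binder row G-an2-4 ∕ (CONV-C), TRANSFER-III (the (III′) column of RULING R-gan24p1-g46-2), THE COMB LEG DICTIONARY,
# SIXTH WORD: **THE COMB-CHART CARRIER's COMPOSITE KERNEL LEG `kChain (krow ∘ G′♮) m k` IS `T^B`-SIZED IN BLOCK MASS — ALL COLUMN FIBRES, UNIFORMLY IN THE PAIR OF LEVELS**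
# — the (III′) twin of the OWNER's part 4 `GAN24/CarrierKernelLegBlockL1` for the comb-chart unit step kernels `G′♮_j := unitK (sfStep Lc j) (smStep d Lc j) (GcombSh Lc j)`
# (OWNER `b2b-balaban-gan24-p1`, gen 47; no existing file touched)

NOT IN PRINT; OUR BOOKKEEPING ([folklore] re-indexing BY NAME over part 4's generic §1 (`kChain_inl_eq_legChain`, `kChain_succ_left`), an2's `GcombSh_eq_conj_psiKS_KInvStep`,
leaf-03's (C-1) `CombLin4Transport.unitK_conj_psiKS`, d1-formalise-leaf-03's apply bridges `SymCorrectorKernel.comp_psiKS_inr ∕ comp_trK_psiKS_inl ∕ comp_trK_psiKS_inr`,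
part 4's `krowInl_dressed_seq ∕ krow_dressed_inr`, and the third ∕ fifth words; 0 `def`, 0 cited facts, 0 `def … : Prop`, 0 sorry).  HONEST FRAMING (cell contract, verbatim):
«discharging `BetaPertH` makes Bałaban's UV stability UNCONDITIONAL — a real constructive-QFT result; it is NOT the continuum limit and NOT the Clay problem.»  HONEST DEPENDENCY
(verbatim): «continuum YM on T⁴ ⇐ BetaPertH ∧ nine spine estimates (0/9 proved); BetaPertH ⇐ (D1) ∧ (D4) ∧ CAP+tail; G-an2-4 gates asym, D1 and NE2/3/4.»

WHY (W-17 l.66387: the supplier route to gan24-formalise-leaf-03 g81's L11 windows W1–W3, displayed on the chains of `G′♮_m`).  `G′♮_j = Ψ̂_S ∘ K♮ᴱ_j ∘ Ψ̂_Sᵀ` with the (E) socket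
kernel `K♮ᴱ_j := unitK_j (coDressKBmAt ρ_c Lc (KInvStep Lc j))` at the CENTRED roots `ρ_c = ctr (d+1) Lc = toSite (ctrOff (d+1) Lc)` (an2's conjugation ⨾ leaf-03's `unitK_conj_psiKS`:
the leg units commute with `Ψ̂_S`).  `Ψ̂_S` is the identity on multiplier indices with vanishing mixed blocks, so the full multiplier ROW `krow G′♮_j` carries `Ψ_S` on its FIELD
columns only: §1 `krow_comb_inl` (`= −Ψ_S (R_j α x″)`, i.e. `−legComp ψ♭ R_j` by `legComp_psiLeg_apply`), `krow_comb_inr` (`=` the UNDRESSED unit kernel's mm entry — part 4's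
`krow_dressed_inr` unchanged); hence the two objects of part 4 at (III′) are the third word's conjugated chain (`kChain_comb_inl`) and the fifth word's (`kChain_comb_inr_succ`), and
§2 re-runs part 4 §3 token for token.
WHAT (`[NeZero Lc]`; §1 generic `d`; §2 `d = 3`, `2 ≤ Lc`; roots FIXED at the centre by `GcombSh`'s definition — no root quantifier):
* §1 `legComp_psiLeg_apply` (`legComp ψ♭ R μ y κ u = Ψ_S (R μ y) κ u`, any `R`: `ψ♭` is row-finite), `combStep_eq_conj`, `krow_comb_inl`, `krowInl_comb_seq`, `krow_comb_inr`,
  `colH_comb_seq ∕ legChain_colH_comb` (the SLOT legs `legChain (j ↦ colH G′♮_j Lc)` ARE the conjugated chains — part 5's object at (III′)),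
  `decays_combStep ∕ klegDecay_krow_comb`, **`kChain_comb_inl`** (`= (−1)^{k+1} · legChain (j ↦ legComp ψ♭ R_j) m k`), **`kChain_comb_inr_succ`**
  (`= (−1)^{k+1} · Σ′_{x′} Σ_{α′} legChain (j ↦ legComp ψ♭ R_j) (m+1) k α x″ α′ x′ · K̃_m (Lc•x′) x (inr α′) (inr β)`).
* §2 **`exists_kChain_comb_blockMass`** (`d = 3`, `2 ≤ Lc`): `∃ κ₁ K″, 0 < κ₁ ∧ 0 ≤ K″ ∧ ∀ m k α x″ f c,
  Σ_{t ∈ box (3+1) (Lc^{k+1})} |kChain (j ↦ krow G′♮_j Lc) m k α x″ f (Lc^{k+1}•c + t)| ≤ K″·(k+1)·(Lc^{k+1})⁻¹·e^{−κ₁‖c − x″‖∞}` — part 4's `exists_kChain_dressed_blockMass` VERBATIM for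
  the comb-chart kernels: the window hypothesis `hl₁` of the (H1♮) core for the (III′) carrier, with the (E) constant shape.
Asserts NOTHING about Bałaban's tables beyond the tree's LANDED K-slot; NOT the slot-leg split (part 5's twin), NOT the windows (parts 6a ∕ 6b's twins), NOT a letter row; the
(III′) campaign is NOT asked (an2 W-4) — typed while idle under R-2; NEVER «G-an2-4 closed» as (CONV-C); NOT D1, NOT `BetaPertH`, NOT continuum, NOT Clay.  2026-08-25.
-/

noncomputable section

open Finset
open scoped BigOperators
open Literature.MathematicalPhysics.QuantumFieldTheory
open Literature.MathematicalPhysics.QuantumFieldTheory.LatticeForm (quo)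
open Literature.MathematicalPhysics.QuantumFieldTheory.Balaban1983to89
open Literature.MathematicalPhysics.QuantumFieldTheory.Balaban1983to89.Beta
open B4ContourShift (supNorm supNorm_nonneg)
open B12Sec2to5 (l1 l1_nonneg)
open ExpKernelCalculus (MKer Decays Zl Zl_nonneg comp)
open Summit.QuantumFields.BalabanUV.Beta.TameKernelCalculus (trK)
open OneStepResolventKernel (Fib)
open OneStepKernelFamily (KInvStep colH)
open AffineAveraging (Site box toSite)
open Summit.QuantumFields.BalabanUV.Beta.HessKerDressedUnits (unitK decays_unitK)
open Summit.QuantumFields.BalabanUV.Beta.AxialDressingRooted (coDressKBmAt)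
open AveragingContoursRooted (ctr ctrOff ctrOff_mem_box)
open Summit.QuantumFields.BalabanUV.Beta.SymCorrectorForms (corrPsiS corrPsiS_smul)
open Summit.QuantumFields.BalabanUV.Beta.SymCorrectorKernel (psiKS psiKS_inl_inl_eq_zero exists_finset_corrReadsS comp_psiKS_inr comp_trK_psiKS_inl comp_trK_psiKS_inr)
open Summit.QuantumFields.BalabanUV.Beta.CombChartStepJets (GcombSh decays_GcombSh)
open Summit.QuantumFields.BalabanUV.Beta.CombChartTransportLevel (GcombSh_eq_conj_psiKS_KInvStep)
open Summit.QuantumFields.BalabanUV.Beta.GAN24.CombesThomas (sfStep smStep sfStep_ne_zero smStep_ne_zero KStepUnit)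
open Summit.QuantumFields.BalabanUV.Beta.HessKerCoDressedBmWall (unitK_coDressKBmAt)
open Summit.QuantumFields.BalabanUV.Beta.SymCorrectorTransport (colH_conj_psiKS)
open Summit.QuantumFields.BalabanUV.Beta.GAN24.KSlotAssembly (convCK_holds)
open Summit.QuantumFields.BalabanUV.Beta.GAN24.Push4 (legComp legComp_apply)
open Summit.QuantumFields.BalabanUV.Beta.GAN24.Push4Iter (LegFam legChain)
open Summit.QuantumFields.BalabanUV.Beta.GAN24.Push4LegTelescopeComb (legChain_neg colH_coDress_seq)
open Summit.QuantumFields.BalabanUV.Beta.GAN24.RespStepBmDecompLegs (legAct legAct_apply)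
open Summit.QuantumFields.BalabanUV.Beta.GAN24.RespStepBmDecompExact (respStepBmSeq)
open Summit.QuantumFields.BalabanUV.Beta.GAN24.LegStepPush (krow supNorm_sub_comm)
open Summit.QuantumFields.BalabanUV.Beta.GAN24.LegChainPush (kChain kChain_zero klegDecay_krow)
open Summit.QuantumFields.BalabanUV.Beta.GAN24.CombLin4Transport (unitK_conj_psiKS)
open Summit.QuantumFields.BalabanUV.Beta.GAN24.CombLegChainGauge (legAct_psiLeg)
open Summit.QuantumFields.BalabanUV.Beta.GAN24.CombLegBlockL1Envelope (exists_legChain_psiLeg_blockL1_envelope)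
open Summit.QuantumFields.BalabanUV.Beta.GAN24.CombLegMultiplierColumnEnvelope (exists_legChain_psiLeg_mmColumn_blockL1_envelope)
open Summit.QuantumFields.BalabanUV.Beta.GAN24.CarrierKernelLegBlockL1 (kChain_inl_eq_legChain kChain_succ_left krowInl_dressed_seq krow_dressed_inr sum_box_abs_mm_le)

namespace Summit.QuantumFields.BalabanUV.Beta.GAN24.CombCarrierKernelLegBlockL1

variable {d : ℕ}

/-! ## §1 The comb-chart unit step kernels: full multiplier rows, field and multiplier columns; the chain identities -/

/-- [folklore] **`legComp ψ♭ R` IS `Ψ_S` OF THE ROW** (any leg family `R`, no summability: `ψ♭` is row-finite — d1-formalise-leaf-03's `exists_finset_corrReadsS ∕ psiKS_inl_inl_eq_zero`;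
the first word's `legAct_psiLeg`): `legComp ψ♭ R μ y κ u = Ψ_S (R μ y) κ u`, `ψ♭ α x κ u := Ψ̂_S u x (inl κ) (inl α)`. -/
theorem legComp_psiLeg_apply {n : ℕ} (hn : 0 < n) {r : Fin (d + 1) → ℕ} (hr : r ∈ box (d + 1) n) (R : LegFam d)
    (μ : Fin (d + 1)) (y : Fin (d + 1) → ℤ) (κ : Fin (d + 1)) (u : Fin (d + 1) → ℤ) :
    legComp (fun α x κ u => psiKS r n u x (Sum.inl κ) (Sum.inl α)) R μ y κ u = corrPsiS (toSite r) n (R μ y) κ u := by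
  classical
  obtain ⟨S, hS⟩ := exists_finset_corrReadsS hn κ u
  have hz : ∀ (lam : Fin (d + 1)) (v : Fin (d + 1) → ℤ), v ∉ S.image Prod.snd →
      R μ y lam v * psiKS r n u v (Sum.inl κ) (Sum.inl lam) = 0 := by
    intro lam v hv
    rw [psiKS_inl_inl_eq_zero hn hr (fun hp => hv (Finset.mem_image_of_mem _ (hS _ hp))), mul_zero]
  rw [legComp_apply, ← legAct_psiLeg hn hr (R μ y), legAct_apply,
    tsum_eq_sum (s := S.image Prod.snd) (fun v hv => Finset.sum_eq_zero fun lam _ => hz lam v hv), Finset.sum_comm]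
  refine Finset.sum_congr rfl fun lam _ => ?_
  rw [tsum_eq_sum (s := S.image Prod.snd) (fun v hv => hz lam v hv)]

section Comb

variable {Lc : ℕ} [NeZero Lc]

/-- [folklore] **THE COMB-CHART UNIT STEP KERNEL IS THE `Ψ̂_S`-CONJUGATE OF THE (E) SOCKET KERNEL AT THE CENTRED ROOT** (an2's `GcombSh_eq_conj_psiKS_KInvStep` ⨾ leaf-03's
`unitK_conj_psiKS` — the leg units commute with `Ψ̂_S`): `unitK_j (GcombSh Lc j) = Ψ̂_S ∘ unitK_j (coDressKBmAt ρ_c Lc (KInvStep Lc j)) ∘ Ψ̂_Sᵀ`, `Ψ̂_S = psiKS (ctrOff (d+1) Lc) Lc`. -/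
theorem combStep_eq_conj (j : ℕ) :
    unitK (sfStep Lc j) (smStep d Lc j) (GcombSh (d := d) Lc j)
      = comp (comp (psiKS (ctrOff (d + 1) Lc) Lc) (unitK (sfStep Lc j) (smStep d Lc j) (coDressKBmAt (ctr (d + 1) Lc) Lc (KInvStep (d := d) Lc j))))
          (trK (psiKS (ctrOff (d + 1) Lc) Lc)) := by
  rw [GcombSh_eq_conj_psiKS_KInvStep Lc j, unitK_conj_psiKS]

/-- NOT IN PRINT; OUR BOOKKEEPING.  **THE FIELD COLUMNS OF THE COMB-CHART FULL ROW ARE `−Ψ_S` OF THE DRESSED ROW**: `krow G′♮_j Lc α x″ (inl κ) x = −Ψ_S (R_j α x″) κ x`,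
`R_j = respStepBmSeq ρ_c Lc j` — `Ψ̂_S`'s multiplier row is the identity (`comp_psiKS_inr`), `Ψ̂_Sᵀ` acts on the fine field column as `Ψ_S` of the row read as a one-form
(`comp_trK_psiKS_inl`), and the (E) row is `−R_j` (part 4's `krowInl_dressed_seq`). -/
theorem krow_comb_inl (j : ℕ) (α : Fin (d + 1)) (x'' : Fin (d + 1) → ℤ) (κ : Fin (d + 1)) (x : Fin (d + 1) → ℤ) :
    krow (unitK (sfStep Lc j) (smStep d Lc j) (GcombSh (d := d) Lc j)) Lc α x'' (Sum.inl κ) x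
      = -(corrPsiS (toSite (ctrOff (d + 1) Lc)) Lc (respStepBmSeq (d := d) (toSite (ctrOff (d + 1) Lc)) Lc j α x'') κ x) := by
  have hLc : 0 < Lc := Nat.pos_of_ne_zero (NeZero.ne Lc)
  have hr : ctrOff (d + 1) Lc ∈ box (d + 1) Lc := ctrOff_mem_box hLc
  rw [krow, combStep_eq_conj, comp_trK_psiKS_inl hLc hr]
  have e : (fun κ' y => comp (psiKS (ctrOff (d + 1) Lc) Lc)
        (unitK (sfStep Lc j) (smStep d Lc j) (coDressKBmAt (ctr (d + 1) Lc) Lc (KInvStep (d := d) Lc j))) ((Lc : ℤ) • x'') y (Sum.inr α) (Sum.inl κ'))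
      = fun κ' y => -(respStepBmSeq (d := d) (toSite (ctrOff (d + 1) Lc)) Lc j α x'' κ' y) := by
    funext κ' y
    rw [comp_psiKS_inr]
    have h := congrFun (congrFun (congrFun (congrFun (congrFun (krowInl_dressed_seq (d := d) (Lc := Lc) (ctr (d + 1) Lc)) j) α) x'') κ') y
    rw [krow] at h
    exact h
  rw [e, show (fun κ' y => -(respStepBmSeq (d := d) (toSite (ctrOff (d + 1) Lc)) Lc j α x'' κ' y))
      = (-1 : ℝ) • respStepBmSeq (d := d) (toSite (ctrOff (d + 1) Lc)) Lc j α x'' from by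
        funext κ' y; simp only [Pi.smul_apply, smul_eq_mul, neg_one_mul],
    corrPsiS_smul, Pi.smul_apply, Pi.smul_apply, smul_eq_mul, neg_one_mul]

/-- [folklore] … as a sequence of leg families: `(j ↦ field columns of krow G′♮_j) = (j ↦ −legComp ψ♭ R_j)` (`legComp_psiLeg_apply`). -/
theorem krowInl_comb_seq :
    (fun j => fun (α : Fin (d + 1)) (x'' : Fin (d + 1) → ℤ) (α' : Fin (d + 1)) (x' : Fin (d + 1) → ℤ) =>
        krow (unitK (sfStep Lc j) (smStep d Lc j) (GcombSh (d := d) Lc j)) Lc α x'' (Sum.inl α') x')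
      = fun j => -(legComp (fun α x κ u => psiKS (ctrOff (d + 1) Lc) Lc u x (Sum.inl κ) (Sum.inl α)) (respStepBmSeq (d := d) (toSite (ctrOff (d + 1) Lc)) Lc j)) := by
  have hLc : 0 < Lc := Nat.pos_of_ne_zero (NeZero.ne Lc)
  have hr : ctrOff (d + 1) Lc ∈ box (d + 1) Lc := ctrOff_mem_box hLc
  funext j α x'' α' x'
  rw [krow_comb_inl, Pi.neg_apply, Pi.neg_apply, Pi.neg_apply, Pi.neg_apply, legComp_psiLeg_apply hLc hr]

/-- [folklore] **THE MULTIPLIER COLUMNS OF THE COMB-CHART FULL ROW ARE THE UNDRESSED UNIT KERNEL's** (`comp_trK_psiKS_inr ∕ comp_psiKS_inr` ⨾ part 4's `krow_dressed_inr`):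
`krow G′♮_j Lc α x″ (inr β) x = K̃_j (Lc•x″) x (inr α) (inr β)`, `K̃_j = unitK_j (KInvStep Lc j)` — the conjugation does not touch them. -/
theorem krow_comb_inr (j : ℕ) (α : Fin (d + 1)) (x'' : Fin (d + 1) → ℤ) (β : Fin (d + 1)) (x : Fin (d + 1) → ℤ) :
    krow (unitK (sfStep Lc j) (smStep d Lc j) (GcombSh (d := d) Lc j)) Lc α x'' (Sum.inr β) x
      = unitK (sfStep Lc j) (smStep d Lc j) (KInvStep (d := d) Lc j) ((Lc : ℤ) • x'') x (Sum.inr α) (Sum.inr β) := by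
  have h := krow_dressed_inr (d := d) (Lc := Lc) (ctr (d + 1) Lc) j α x'' β x
  rw [krow] at h
  rw [krow, combStep_eq_conj, comp_trK_psiKS_inr, comp_psiKS_inr, h]

/-- [folklore] The comb-chart unit step kernels decay at positive rates (an2's `decays_GcombSh` ⨾ an5's `decays_unitK`). -/
theorem decays_combStep (j : ℕ) : ∃ C μ : ℝ, 0 < μ ∧ Decays (unitK (sfStep Lc j) (smStep d Lc j) (GcombSh (d := d) Lc j)) C μ := by
  obtain ⟨δ, C, hδ, -, hK⟩ := decays_GcombSh (d := d) Lc j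
  exact ⟨_, δ, hδ, decays_unitK hK⟩

/-- [folklore] … hence their full rows are levelwise localised full-row legs (leaf-01's `klegDecay_krow`). -/
theorem klegDecay_krow_comb :
    ∀ j, ∃ C μ : ℝ, 0 < μ ∧ ∀ (α : Fin (d + 1)) (x' : Fin (d + 1) → ℤ) (g : Fib d) (x : Fin (d + 1) → ℤ),
      |krow (unitK (sfStep Lc j) (smStep d Lc j) (GcombSh (d := d) Lc j)) Lc α x' g x| ≤ C * Real.exp (-μ * l1 (x - (Lc : ℤ) • x')) := fun j => by
  obtain ⟨C, μ, hμ, hK⟩ := decays_combStep (d := d) (Lc := Lc) j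
  exact ⟨C, μ, hμ, fun α x' g x => klegDecay_krow hK Lc α x' g x⟩

/-- NOT IN PRINT; OUR BOOKKEEPING.  **THE FIELD COLUMNS OF THE COMB-CHART CARRIER's COMPOSITE KERNEL LEG ARE THE CONJUGATED ROW CHAIN, UP TO SIGN**:
`kChain (j ↦ krow G′♮_j Lc) m k α x″ (inl κ) x = (−1)^{k+1} · legChain (j ↦ legComp ψ♭ R_j) m k α x″ κ x` (part 4 §1 ⨾ `krowInl_comb_seq` ⨾ `legChain_neg`) — the third word's object. -/
theorem kChain_comb_inl (m k : ℕ) (α : Fin (d + 1)) (x'' : Fin (d + 1) → ℤ) (κ : Fin (d + 1)) (x : Fin (d + 1) → ℤ) :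
    kChain (fun j => krow (unitK (sfStep Lc j) (smStep d Lc j) (GcombSh (d := d) Lc j)) Lc) m k α x'' (Sum.inl κ) x
      = (-1 : ℝ) ^ (k + 1) * legChain (fun j => legComp (fun α x κ u => psiKS (ctrOff (d + 1) Lc) Lc u x (Sum.inl κ) (Sum.inl α))
          (respStepBmSeq (d := d) (toSite (ctrOff (d + 1) Lc)) Lc j)) m k α x'' κ x := by
  rw [kChain_inl_eq_legChain, krowInl_comb_seq,
    legChain_neg (fun j => legComp (fun α x κ u => psiKS (ctrOff (d + 1) Lc) Lc u x (Sum.inl κ) (Sum.inl α))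
      (respStepBmSeq (d := d) (toSite (ctrOff (d + 1) Lc)) Lc j)) m k]
  rfl

/-- NOT IN PRINT; OUR BOOKKEEPING.  **THE MULTIPLIER COLUMNS OF THE COMB-CHART CARRIER's COMPOSITE KERNEL LEG (WINDOWS OF LENGTH ≥ 2) ARE THE FIFTH WORD's OBJECT, UP TO SIGN**:
`kChain (j ↦ krow G′♮_j Lc) m (k+1) α x″ (inr β) x = (−1)^{k+1} · Σ′_{x′} Σ_{α′} legChain (j ↦ legComp ψ♭ R_j) (m+1) k α x″ α′ x′ · K̃_m (Lc•x′) x (inr α′) (inr β)`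
(part 4's `kChain_succ_left` ⨾ `krowInl_comb_seq` ⨾ `legChain_neg` ⨾ `krow_comb_inr`). -/
theorem kChain_comb_inr_succ (hLc : 1 ≤ Lc) (m k : ℕ) (α : Fin (d + 1)) (x'' : Fin (d + 1) → ℤ) (β : Fin (d + 1)) (x : Fin (d + 1) → ℤ) :
    kChain (fun j => krow (unitK (sfStep Lc j) (smStep d Lc j) (GcombSh (d := d) Lc j)) Lc) m (k + 1) α x'' (Sum.inr β) x
      = (-1 : ℝ) ^ (k + 1) * ∑' x', ∑ α' : Fin (d + 1),
          legChain (fun j => legComp (fun α x κ u => psiKS (ctrOff (d + 1) Lc) Lc u x (Sum.inl κ) (Sum.inl α))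
              (respStepBmSeq (d := d) (toSite (ctrOff (d + 1) Lc)) Lc j)) (m + 1) k α x'' α' x' *
            unitK (sfStep Lc m) (smStep d Lc m) (KInvStep (d := d) Lc m) ((Lc : ℤ) • x') x (Sum.inr α') (Sum.inr β) := by
  rw [kChain_succ_left hLc (klegDecay_krow_comb (d := d) (Lc := Lc)) m k, krowInl_comb_seq,
    legChain_neg (fun j => legComp (fun α x κ u => psiKS (ctrOff (d + 1) Lc) Lc u x (Sum.inl κ) (Sum.inl α))
      (respStepBmSeq (d := d) (toSite (ctrOff (d + 1) Lc)) Lc j)) (m + 1) k, ← tsum_mul_left]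
  refine tsum_congr fun x' => ?_
  simp only [Pi.smul_apply, smul_eq_mul, krow_comb_inr, Finset.mul_sum, mul_assoc]

/-- NOT IN PRINT; OUR BOOKKEEPING.  **THE SLOT LEGS TOO: THE `ℋ`-COLUMN FAMILIES OF THE COMB-CHART UNIT STEP KERNELS ARE THE CONJUGATED DRESSED LEGS** —
`(j ↦ colH G′♮_j Lc) = (j ↦ legComp ψ♭ R_j)` (an2 ∕ leaf-03's `colH_conj_psiKS` ⨾ asym1's `unitK_coDressKBmAt` ⨾ leaf-03's `colH_coDress_seq` ⨾ `legComp_psiLeg_apply`): the (III′)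
composite SLOT legs `legChain (j ↦ colH G′♮_j Lc) m k` of the window (part 5's object) ARE the conjugated chains of the first five words — no sign, no extra term. -/
theorem colH_comb_seq :
    (fun j => colH (unitK (sfStep Lc j) (smStep d Lc j) (GcombSh (d := d) Lc j)) Lc)
      = fun j => legComp (fun α x κ u => psiKS (ctrOff (d + 1) Lc) Lc u x (Sum.inl κ) (Sum.inl α)) (respStepBmSeq (d := d) (toSite (ctrOff (d + 1) Lc)) Lc j) := by
  have hLc : 0 < Lc := Nat.pos_of_ne_zero (NeZero.ne Lc)
  have hr : ctrOff (d + 1) Lc ∈ box (d + 1) Lc := ctrOff_mem_box hLc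
  funext j μ y κ v
  rw [combStep_eq_conj, colH_conj_psiKS hLc hr, legComp_psiLeg_apply hLc hr,
    unitK_coDressKBmAt (ctr (d + 1) Lc) Lc (sfStep_ne_zero j) (smStep_ne_zero j)]
  have h2 := congrFun (congrFun (congrFun (colH_coDress_seq (d := d) (Lc := Lc) (ctr (d + 1) Lc)) j) μ) y
  rw [h2]
  rfl

/-- [folklore] … hence **THE (III′) COMPOSITE SLOT LEGS ARE THE CONJUGATED CHAINS**: `legChain (j ↦ colH G′♮_j Lc) m k = legChain (j ↦ legComp ψ♭ R_j) m k` — every word of the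
comb LEG dictionary (decomposition, sawtooth, block-ℓ¹, sup) applies to the window's slot legs verbatim. -/
theorem legChain_colH_comb (m k : ℕ) :
    legChain (fun j => colH (unitK (sfStep Lc j) (smStep d Lc j) (GcombSh (d := d) Lc j)) Lc) m k
      = legChain (fun j => legComp (fun α x κ u => psiKS (ctrOff (d + 1) Lc) Lc u x (Sum.inl κ) (Sum.inl α))
          (respStepBmSeq (d := d) (toSite (ctrOff (d + 1) Lc)) Lc j)) m k := by
  rw [colH_comb_seq]

end Comb

/-! ## §2 The block mass of the comb-chart carrier's composite kernel leg (`d = 3`) -/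

section Three

variable {Lc : ℕ} [NeZero Lc]

/-- NOT IN PRINT; OUR BOOKKEEPING.  **THE COMB-CHART CARRIER's COMPOSITE KERNEL LEG IS `T^B`-SIZED IN BLOCK MASS — ALL COLUMN FIBRES, UNIFORMLY IN THE PAIR OF LEVELS** (`d = 3`,
`2 ≤ Lc`; roots fixed at the centre): `∃ κ₁ K″, 0 < κ₁ ∧ 0 ≤ K″ ∧ ∀ m k α x″ f c, Σ_{t ∈ box (Lc^{k+1})} |kChain (j ↦ krow G′♮_j Lc) m k α x″ f (Lc^{k+1}•c + t)| ≤ K″·(k+1)·(Lc^{k+1})⁻¹·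
e^{−κ₁‖c − x″‖∞}` — part 4's `exists_kChain_dressed_blockMass` for the comb-chart kernels, its proof token for token: field columns by the third word
(`CombLegBlockL1Envelope.exists_legChain_psiLeg_blockL1_envelope`, through `kChain_comb_inl`), multiplier columns of windows of length `≥ 2` by the fifth word
(`CombLegMultiplierColumnEnvelope.exists_legChain_psiLeg_mmColumn_blockL1_envelope`, through `kChain_comb_inr_succ`), windows of length one by the K-slot (`KSlotAssembly.convCK_holds`,
part 4's `sum_box_abs_mm_le`, through `krow_comb_inr`); rates merged by `min`, constants by `+`.  THIS is the kernel-leg hypothesis `hl₁` of the (H1♮) window for the (III′) carrier. -/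
theorem exists_kChain_comb_blockMass (hLc : 2 ≤ Lc) :
    ∃ κ₁ K'' : ℝ, 0 < κ₁ ∧ 0 ≤ K'' ∧
      ∀ (m k : ℕ) (α : Fin (3 + 1)) (x'' : Site (3 + 1)) (f : Fib 3) (c : Site (3 + 1)),
        ∑ t ∈ box (3 + 1) (Lc ^ (k + 1)),
            |kChain (fun j => krow (unitK (sfStep Lc j) (smStep 3 Lc j) (GcombSh (d := 3) Lc j)) Lc) m k α x'' f
                (((Lc ^ (k + 1) : ℕ) : ℤ) • c + toSite t)|
          ≤ K'' * ((k : ℝ) + 1) * ((Lc : ℝ) ^ (k + 1))⁻¹ * Real.exp (-(κ₁ * supNorm (c - x''))) := by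
  classical
  have hLc1 : 1 ≤ Lc := le_trans (by norm_num) hLc
  have hLpos : (0 : ℝ) < (Lc : ℝ) := by exact_mod_cast (show 0 < Lc by omega)
  have hr : ctrOff (3 + 1) Lc ∈ box (3 + 1) Lc := ctrOff_mem_box (show 0 < Lc by omega)
  obtain ⟨κ₀, K, hκ₀, hK, hlaw⟩ := exists_legChain_psiLeg_blockL1_envelope (Lc := Lc)
  obtain ⟨κ₂, K', hκ₂, hK', hlaw'⟩ := exists_legChain_psiLeg_mmColumn_blockL1_envelope (Lc := Lc) hLc
  obtain ⟨CK, δK, cc, θ, hδK, -, -, hU, -⟩ := convCK_holds (Lc := Lc) hLc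
  have hCK : 0 ≤ CK := by
    have h := hU 0 0 0 (Sum.inl 0) (Sum.inl 0)
    have h0 : (0 : ℝ) ≤ CK * Real.exp (-δK * l1 ((0 : Site (3 + 1)) - 0)) := (abs_nonneg _).trans h
    rw [sub_self] at h0
    have : l1 (0 : Site (3 + 1)) = 0 := by unfold l1; simp
    rw [this, mul_zero, Real.exp_zero, mul_one] at h0
    exact h0
  set κ₁ : ℝ := min (min κ₀ κ₂) (δK / 4) with hκ₁
  have hκ₁0 : 0 < κ₁ := lt_min (lt_min hκ₀ hκ₂) (by positivity)
  have hκ₁κ₀ : κ₁ ≤ κ₀ := (min_le_left _ _).trans (min_le_left _ _)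
  have hκ₁κ₂ : κ₁ ≤ κ₂ := (min_le_left _ _).trans (min_le_right _ _)
  have h4 : 4 * κ₁ ≤ δK := by have := min_le_right (min κ₀ κ₂) (δK / 4); rw [← hκ₁] at this; linarith
  have hZ := Zl_nonneg (D := 3 + 1) (show 0 < δK / 2 by positivity)
  set K'' : ℝ := K + K' * Lc + CK * Zl (3 + 1) (δK / 2) * Real.exp (2 * κ₁) * Lc with hK''
  have hP1 : 0 ≤ K' * Lc := mul_nonneg hK' hLpos.le
  have hP2 : 0 ≤ CK * Zl (3 + 1) (δK / 2) * Real.exp (2 * κ₁) * Lc :=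
    mul_nonneg (mul_nonneg (mul_nonneg hCK hZ) (Real.exp_pos (2 * κ₁)).le) hLpos.le
  have hK''0 : 0 ≤ K'' := by rw [hK'']; linarith
  have hKle : K ≤ K'' := by rw [hK'']; linarith
  have hK'le : K' * Lc ≤ K'' := by rw [hK'']; linarith
  have hCle : CK * Zl (3 + 1) (δK / 2) * Real.exp (2 * κ₁) * Lc ≤ K'' := by rw [hK'']; linarith
  have hLne : (Lc : ℝ) ≠ 0 := hLpos.ne'
  -- rate weakening
  have hexp : ∀ {κ : ℝ} (s : ℝ), 0 ≤ s → κ₁ ≤ κ → Real.exp (-(κ * s)) ≤ Real.exp (-(κ₁ * s)) := fun s hs hκ => by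
    rw [Real.exp_le_exp]; nlinarith
  refine ⟨κ₁, K'', hκ₁0, hK''0, ?_⟩
  intro m k α x'' f c
  have hs : 0 ≤ supNorm (c - x'') := supNorm_nonneg _
  have hkpos : (0 : ℝ) ≤ (k : ℝ) + 1 := by positivity
  have hLk : (0 : ℝ) < ((Lc : ℝ) ^ (k + 1))⁻¹ := by positivity
  rcases f with κ | β
  · -- field columns: the third word's law for the conjugated row chain (the sign is invisible to the block mass)
    have e : ∀ t, |kChain (fun j => krow (unitK (sfStep Lc j) (smStep 3 Lc j) (GcombSh (d := 3) Lc j)) Lc) m k α x''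
          (Sum.inl κ) (((Lc ^ (k + 1) : ℕ) : ℤ) • c + toSite t)|
        = |legChain (fun j => legComp (fun α x κ u => psiKS (ctrOff (3 + 1) Lc) Lc u x (Sum.inl κ) (Sum.inl α))
            (respStepBmSeq (d := 3) (toSite (ctrOff (3 + 1) Lc)) Lc j)) m k α x'' κ (((Lc ^ (k + 1) : ℕ) : ℤ) • c + toSite t)| := fun t => by
      rw [kChain_comb_inl, abs_mul, abs_pow, abs_neg, abs_one, one_pow, one_mul]
    simp only [e]
    refine (hlaw _ hr _ hr m k α x'' κ c).trans ?_
    have h1 : K * ((k : ℝ) + 1) * ((Lc : ℝ) ^ (k + 1))⁻¹ ≤ K'' * ((k : ℝ) + 1) * ((Lc : ℝ) ^ (k + 1))⁻¹ :=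
      mul_le_mul_of_nonneg_right (mul_le_mul_of_nonneg_right hKle hkpos) hLk.le
    exact mul_le_mul h1 (hexp _ hs hκ₁κ₀) (Real.exp_pos _).le (mul_nonneg (mul_nonneg hK''0 hkpos) hLk.le)
  · cases k with
    | zero =>
      -- a window of length one: the mm block of `K̃_m` alone, block-summed at blocking `Lc`
      simp only [kChain_zero, krow_comb_inr, zero_add, pow_one, Nat.cast_zero, mul_one]
      have hM : ∀ x' x, |unitK (sfStep Lc m) (smStep 3 Lc m) (KInvStep (d := 3) Lc m) ((Lc : ℤ) • x') x (Sum.inr α) (Sum.inr β)|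
          ≤ CK * Real.exp (-δK * l1 ((Lc : ℤ) • x' - x)) := fun x' x => hU m _ _ _ _
      refine (sum_box_abs_mm_le (d := 3) hLc1 hκ₁0.le hδK h4 hCK hM x'' c).trans ?_
      rw [supNorm_sub_comm c x'']
      have h1 : CK * Zl (3 + 1) (δK / 2) * Real.exp (2 * κ₁) ≤ K'' * ((Lc : ℝ))⁻¹ := by
        have e1 : CK * Zl (3 + 1) (δK / 2) * Real.exp (2 * κ₁) = (CK * Zl (3 + 1) (δK / 2) * Real.exp (2 * κ₁) * Lc) * ((Lc : ℝ))⁻¹ := by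
          field_simp
        rw [e1]
        exact mul_le_mul_of_nonneg_right hCle (inv_nonneg.2 hLpos.le)
      have h2 : Real.exp (-(2 * κ₁) * supNorm (c - x'')) ≤ Real.exp (-(κ₁ * supNorm (c - x''))) := by
        rw [Real.exp_le_exp]; nlinarith
      exact mul_le_mul h1 h2 (Real.exp_pos _).le (mul_nonneg hK''0 (inv_nonneg.2 hLpos.le))
    | succ k =>
      -- windows of length ≥ 2 at a multiplier column: the fifth word's law (the sign is invisible)
      have e : ∀ t, |kChain (fun j => krow (unitK (sfStep Lc j) (smStep 3 Lc j) (GcombSh (d := 3) Lc j)) Lc) m (k + 1) α x''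
            (Sum.inr β) (((Lc ^ (k + 1 + 1) : ℕ) : ℤ) • c + toSite t)|
          = |∑' x', ∑ α' : Fin (3 + 1), legChain (fun j => legComp (fun α x κ u => psiKS (ctrOff (3 + 1) Lc) Lc u x (Sum.inl κ) (Sum.inl α))
              (respStepBmSeq (d := 3) (toSite (ctrOff (3 + 1) Lc)) Lc j)) (m + 1) k α x'' α' x' *
              unitK (sfStep Lc m) (smStep 3 Lc m) (KInvStep (d := 3) Lc m) ((Lc : ℤ) • x') (((Lc ^ (k + 2) : ℕ) : ℤ) • c + toSite t) (Sum.inr α') (Sum.inr β)| :=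
        fun t => by rw [kChain_comb_inr_succ hLc1, abs_mul, abs_pow, abs_neg, abs_one, one_pow, one_mul]
      simp only [e]
      refine (hlaw' _ hr _ hr m k α x'' β c).trans ?_
      have hLk2 : (0 : ℝ) < ((Lc : ℝ) ^ (k + 1 + 1))⁻¹ := by positivity
      have e2 : K' * Lc * ((Lc : ℝ) ^ (k + 1 + 1))⁻¹ = K' * ((Lc : ℝ) ^ (k + 1))⁻¹ := by
        rw [pow_succ]; field_simp
      have h1 : K' * ((k : ℝ) + 1) * ((Lc : ℝ) ^ (k + 1))⁻¹ ≤ K'' * (((k + 1 : ℕ) : ℝ) + 1) * ((Lc : ℝ) ^ (k + 1 + 1))⁻¹ := by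
        calc K' * ((k : ℝ) + 1) * ((Lc : ℝ) ^ (k + 1))⁻¹
            = (K' * Lc * ((Lc : ℝ) ^ (k + 1 + 1))⁻¹) * ((k : ℝ) + 1) := by rw [e2]; ring
          _ ≤ (K'' * ((Lc : ℝ) ^ (k + 1 + 1))⁻¹) * (((k + 1 : ℕ) : ℝ) + 1) := by
              refine mul_le_mul (mul_le_mul_of_nonneg_right hK'le hLk2.le) ?_ (by positivity) (mul_nonneg hK''0 hLk2.le)
              push_cast; linarith
          _ = _ := by ring
      exact mul_le_mul h1 (hexp _ hs hκ₁κ₂) (Real.exp_pos _).le (mul_nonneg (mul_nonneg hK''0 (by positivity)) hLk2.le)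

end Three

end Summit.QuantumFields.BalabanUV.Beta.GAN24.CombCarrierKernelLegBlockL1

end
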